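import Mathlib
import HarnessLib
import Summits.Langlands.Langlands.Theses.QuarterDeficit1951

/-!
# Line `ParitySplit` — the parity DECOMPOSITION of crux stmt-Langlands-15897
`Summit.Langlands.Langlands.Theses.QuarterDeficit1951.QuarterFingerprintDeficit` (C1)

PROOF-direction skeleton (passes `#h21_check_skeleton`: `QuarterFingerprintDeficit_proof` concludes the crux BY NAME)
recording the typed split that the refutation line `Lines/ParityPurePoint.lean` exploits:

  `ParityClosure → DeficitOdd → DeficitEven → QuarterFingerprintDeficit`   (`deficit_of_paritySplit`, PROVED here)

* `ParityClosure` (stub, TRUE, kernel-provable, M/L): the crux's witness class `IsForm χ · λ` is closed under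
  odd/even symmetrisation `u ↦ u ∓ u∘R` (`R : z ↦ -z̄` = `UpperHalfPlane.J • ·`), with the SAME `T_p`-eigenvalues
  (`T_p` is linear and commutes with `R`; `Δ` commutes with `R`; automorphy with the same `χ` transports since
  `RγR = [[a,-b],[-c,d]]`; the constant-term clauses transport by `x ↦ -x` and periodicity; boundedness is clear).
* `DeficitOdd` (stub) = C1 restricted to ODD witnesses. EXPECTED FALSE — it is the refutation target: the sighted
  Doud–Moore forms are odd (SightingHejhalR0.md §2, ε = −1), and the odd sector of `(Γ₀(1951), χ)` is purely
  cuspidal (ParityPurePoint: every Eisenstein series `E_{1,χ}`, `E_{χ,1}` is `R`-even), so an Arb quasimode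
  certificate needs NO Eisenstein annihilator there. NOT a proving task.
* `DeficitEven` (stub) = C1 restricted to EVEN witnesses. Plausibly TRUE (no even icosahedral form at 1951; an
  accidental fingerprinted even window form has heuristic probability ≈ 10⁻⁶), certifiable only by an even-sector
  census (cards count-identify-census / christoffel-hecke-census with the `T₋₁`-twisted trace formula) — NOT needed
  for the route, which closes `refuted:QuarterFingerprintDeficit` as soon as `DeficitOdd` is refuted
  (`QuarterFingerprintDeficit → DeficitOdd` is the trivial direction, `deficitOdd_of_deficit` below).

Glue: `u = ((u − u∘R) + (u + u∘R))/2`, so a witness `u ≢ 0` has a nonzero odd or even part, which is again a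
witness (ParityClosure) of fixed parity. [folklore]
-/

set_option linter.dupNamespace false

noncomputable section

namespace Summit.Langlands.Langlands.Cruxes.QuarterFingerprintDeficit.ParitySplit

open Summit.Langlands.Langlands.Theses.QuarterDeficit1951
open scoped BigOperators ComplexConjugate MatrixGroups
open UpperHalfPlane (J ofComplex)

/-! ## 0. The crux's `let`s, named (verbatim) -/

/-- `Φ = {0, 1, 4, (3 ± √5)/2}`. [folklore] -/
def Φ : Set ℂ := {0, 1, 4, (((3 + Real.sqrt 5) / 2 : ℝ) : ℂ), (((3 - Real.sqrt 5) / 2 : ℝ) : ℂ)}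

/-- The six fingerprint primes. [folklore] -/
def P₀ : Finset ℕ := {2, 3, 5, 7, 11, 13}

/-- The crux's `IsForm χ u λ` (verbatim). [folklore] -/
def IsForm (χ : DirichletCharacter ℂ 1951) (u : UpperHalfPlane → ℂ) (lam : ℝ) : Prop :=
  Literature.NumberTheory.Automorphic.IsC2 u ∧
  (∀ z, Literature.NumberTheory.Automorphic.hypLaplacian u z + (lam : ℂ) * u z = 0) ∧
  (∀ γ : Matrix.SpecialLinearGroup (Fin 2) ℤ, γ ∈ CongruenceSubgroup.Gamma0 1951 →
    ∀ z : UpperHalfPlane, u (γ • z) = χ ((γ 1 1 : ℤ) : ZMod 1951) * u z) ∧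
  (∀ y : ℝ, 0 < y → ∫ x in (0 : ℝ)..1, u (ofComplex (x + y * Complex.I)) = 0) ∧
  (∀ y : ℝ, 0 < y →
    ∫ x in (0 : ℝ)..1951, u (ModularGroup.S • ofComplex (x + y * Complex.I)) = 0) ∧
  (∃ C : ℝ, ∀ z, ‖u z‖ ≤ C)

/-- The crux's Hecke operator (verbatim). [folklore] -/
def Tp (χ : DirichletCharacter ℂ 1951) (p : ℕ) (u : UpperHalfPlane → ℂ) (z : UpperHalfPlane) : ℂ :=
  ((Real.sqrt p : ℝ) : ℂ)⁻¹ *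
    ((∑ b ∈ Finset.range p, u (ofComplex (((z : ℂ) + b) / p))) +
      χ (p : ZMod 1951) * u (ofComplex ((p : ℂ) * z)))

/-- The crux's windowed fingerprint clause at the six primes. [folklore] -/
def Fingerprint (χ : DirichletCharacter ℂ 1951) (u : UpperHalfPlane → ℂ) : Prop :=
  ∀ p ∈ P₀, ∃ μ φ : ℂ, φ ∈ Φ ∧ (∀ z, Tp χ p u z = μ * u z) ∧
    ‖μ ^ 2 * (starRingEnd ℂ) (χ (p : ZMod 1951)) - φ‖ ≤ 1 / 100

/-! ## 1. The three pieces -/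

/-- SUB-CRUX `DeficitOdd`: C1 restricted to witnesses ODD under `R : z ↦ -z̄`. EXPECTED FALSE (refutation target:
the sighted λ = 1/4 Doud–Moore newforms are odd); its refutation refutes C1 (`deficitOdd_of_deficit`). [folklore] -/
def DeficitOdd : Prop :=
  ∀ χ : DirichletCharacter ℂ 1951, orderOf χ = 5 → ¬ ∃ (u : UpperHalfPlane → ℂ) (lam : ℝ),
    IsForm χ u lam ∧ (∀ z, u (J • z) = - u z) ∧ (∃ z, u z ≠ 0) ∧ |lam - 1 / 4| ≤ 1 / 100 ∧ Fingerprint χ u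

/-- SUB-CRUX `DeficitEven`: C1 restricted to witnesses EVEN under `R`. Plausibly true; certifiable only by an
even-sector census; moot for the route once `DeficitOdd` is refuted. [folklore] -/
def DeficitEven : Prop :=
  ∀ χ : DirichletCharacter ℂ 1951, orderOf χ = 5 → ¬ ∃ (u : UpperHalfPlane → ℂ) (lam : ℝ),
    IsForm χ u lam ∧ (∀ z, u (J • z) = u z) ∧ (∃ z, u z ≠ 0) ∧ |lam - 1 / 4| ≤ 1 / 100 ∧ Fingerprint χ u

/-- SUPPORT `ParityClosure` (TRUE; kernel-provable, M/L): the crux's witness class is closed under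
`u ↦ u − u∘R` and `u ↦ u + u∘R` with the same `λ`, and these have the same `T_p`-eigenvalues as `u`.
Ingredients: `IsC2`/`hypLaplacian` under the isometry `w ↦ -w̄` and their linearity; `RγR = [[a,-b],[-c,d]]`;
`∫₀¹ u(-x+iy)dx = ∫₀¹ u(x+iy)dx` by `x ↦ -x` + period 1 (resp. 1951 at the cusp 0, via `S T^{1951} S⁻¹ ∈ Γ₀(1951)`
and `S•(Rw) = R(S•w)`), integrability from continuity; `T_p` linear and `T_p (u∘R) = (T_p u)∘R` (reindex
`b ↦ p − b` using period 1). [folklore] -/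
def ParityClosure : Prop :=
  ∀ (χ : DirichletCharacter ℂ 1951) (u : UpperHalfPlane → ℂ) (lam : ℝ), IsForm χ u lam →
    (IsForm χ (fun z => u z - u (J • z)) lam ∧ IsForm χ (fun z => u z + u (J • z)) lam) ∧
    ∀ p ∈ P₀, ∀ μ : ℂ, (∀ z, Tp χ p u z = μ * u z) →
      (∀ z, Tp χ p (fun w => u w - u (J • w)) z = μ * (u z - u (J • z))) ∧
      (∀ z, Tp χ p (fun w => u w + u (J • w)) z = μ * (u z + u (J • z)))

/-- STUB (TRUE, Lean M/L): parity closure of the witness class. -/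
theorem stub_parityClosure : ParityClosure := by
  sorry

/-- STUB (EXPECTED FALSE — refutation target, NOT a proving task): no odd fingerprinted window form. -/
theorem stub_deficitOdd : DeficitOdd := by
  sorry

/-- STUB (plausibly true; even-sector census; not needed for the route): no even fingerprinted window form. -/
theorem stub_deficitEven : DeficitEven := by
  sorry

/-! ## 2. Glue (proved) -/

/-- `R` is an involution on `ℍ`. [folklore] -/
theorem J_smul_J_smul (z : UpperHalfPlane) : J • J • z = z := by
  rw [smul_smul, ← sq, UpperHalfPlane.J_sq, one_smul]

/-- The split implication as a named proposition (so that the skeleton audit sees exactly ONE theorem concluding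
the crux by name, `QuarterFingerprintDeficit_proof`). [folklore] -/
def ParitySplitImplication : Prop :=
  ParityClosure → DeficitOdd → DeficitEven → QuarterFingerprintDeficit

/-- THE SPLIT (sorry-free): `ParityClosure → DeficitOdd → DeficitEven → QuarterFingerprintDeficit`.
A crux witness `u ≢ 0` has a nonzero odd part `u − u∘R` or a nonzero even part `u + u∘R`
(`u = ((u − u∘R) + (u + u∘R))/2`); by `ParityClosure` that part is again a witness, of fixed parity. -/
theorem deficit_of_paritySplit : ParitySplitImplication := by
  intro hC hO hE χ hχ hex
  obtain ⟨u, lam, hform, ⟨z₀, hz₀⟩, hwin, hfp⟩ := hex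
  obtain ⟨⟨hformO, hformE⟩, hT⟩ := hC χ u lam hform
  have hfpO : Fingerprint χ (fun z => u z - u (J • z)) := by
    intro p hp
    obtain ⟨μ, φ, hφ, hTu, hfin⟩ := hfp p hp
    exact ⟨μ, φ, hφ, (hT p hp μ hTu).1, hfin⟩
  have hfpE : Fingerprint χ (fun z => u z + u (J • z)) := by
    intro p hp
    obtain ⟨μ, φ, hφ, hTu, hfin⟩ := hfp p hp
    exact ⟨μ, φ, hφ, (hT p hp μ hTu).2, hfin⟩
  by_cases ho : ∃ z, u z - u (J • z) ≠ 0
  · exact hO χ hχ ⟨fun z => u z - u (J • z), lam, hformO,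
      fun z => by simp only [J_smul_J_smul]; ring, ho, hwin, hfpO⟩
  · by_cases he : ∃ z, u z + u (J • z) ≠ 0
    · exact hE χ hχ ⟨fun z => u z + u (J • z), lam, hformE,
        fun z => by simp only [J_smul_J_smul]; ring, he, hwin, hfpE⟩
    · push Not at ho he
      apply hz₀
      have h1 := ho z₀
      have h2 := he z₀
      linear_combination (h1 + h2) / 2

/-- The trivial direction: C1 implies its odd restriction (an odd witness is a witness). So a refutation of
`DeficitOdd` is a refutation of C1. [folklore] -/
theorem deficitOdd_of_deficit (h : QuarterFingerprintDeficit) : DeficitOdd := by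
  intro χ hχ ⟨u, lam, hform, _hodd, hne, hwin, hfp⟩
  exact h χ hχ ⟨u, lam, hform, hne, hwin, hfp⟩

/-- Likewise for the even restriction. [folklore] -/
theorem deficitEven_of_deficit (h : QuarterFingerprintDeficit) : DeficitEven := by
  intro χ hχ ⟨u, lam, hform, _hev, hne, hwin, hfp⟩
  exact h χ hχ ⟨u, lam, hform, hne, hwin, hfp⟩

/-- SKELETON THEOREM: the crux BY NAME from the three registered stubs. -/
theorem QuarterFingerprintDeficit_proof : QuarterFingerprintDeficit :=
  (show ParityClosure → DeficitOdd → DeficitEven → QuarterFingerprintDeficit from deficit_of_paritySplit)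
    stub_parityClosure stub_deficitOdd stub_deficitEven

end Summit.Langlands.Langlands.Cruxes.QuarterFingerprintDeficit.ParitySplit

end
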